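import Summits.QuantumFields.YangMills.Theorems.FluctuationComparisonRegPrIntLS2BetaChartContBlindChain
import Summits.QuantumFields.YangMills.Theorems.FluctuationComparisonRegPrIntLS2BetaChartContChainCharts
import HarnessLib

/-!
# CHART∞ · IV-b (LINE g18-1 `semiclassical_s2beta`, organ S2β, LAPLACE row): the chain's inversion data, jointly continuous AND pivot-blind

R3 = Balaban's UV-stability programme on the finite 3-torus, gauge group `SU(N)` (generic `(P, N)` here) — NOT d = 4, NOT infinite volume, NOT a mass gap,
NOT Clay; the Yang–Mills gap is NOT proved by anything in this file.  Helper toward crux `stmt-QuantumFields-20520` (`FluctuationComparisonRegPrIntL`),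
LINE g18-1, LAPLACE row, letter CHART∞ (IV).

★★★`exists_chainCharts_cont_blind` = Part II's ✓`exists_chainCharts_cont` (fifteen conjuncts VERBATIM, same proof) built on Part IV-a's pivot-blind chain density
✓`chain_forwardLaw_contOn_blind`, with three more conjuncts: the image window `T c U`, the inverse `ϑ c U v` (`v ∈ T c U`) and the inverse density `jd c U v`
(`v ∈ T c U`) do not change when the pivots of `U` are resampled (`U ↦ extend (iterCentralBond n) g U`).  [cite: Balaban1987RG1, (0.4) p.253 and (2.10) p.267]
-/

noncomputable section

open MeasureTheory Filter Topology Set Function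
open scoped ENNReal NNReal
open Literature.MathematicalPhysics.QuantumFieldTheory.Balaban1983to89
open Literature.MathematicalPhysics.QuantumFieldTheory.Balaban1983to89.T4Continuum
open Literature.MathematicalPhysics.QuantumFieldTheory.Balaban1983to89.BlockAveraging (Idx avgFun measurable_avgFun loopHol)
open Literature.MathematicalPhysics.QuantumFieldTheory.Balaban1983to89.BlockAveragingHaarAC (centralBond pre post)
open Literature.MathematicalPhysics.QuantumFieldTheory.Balaban1983to89.BlockAveragingEMLHaarAC (fibreFamily offCard)
open Literature.MathematicalPhysics.QuantumFieldTheory.Balaban1983to89.ExpMeanLog (expMeanLogSU deltaSU deltaSU_pos measurable_expMeanLogSU_E)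
open Literature.MathematicalPhysics.QuantumFieldTheory.Balaban1983to89.Node00 (SU)
open Summit.QuantumFields.YangMills.Theorems.FluctuationComparisonRegPrIntLWregChain
open Summit.QuantumFields.YangMills.Theorems.FluctuationComparisonRegPrIntLWregFibredChart (measurableSet_chainWindow₂ chainMap_extend chainWindow_extend)
open Summit.QuantumFields.YangMills.Theorems.FluctuationComparisonRegPrIntLS2BetaChartContChain
open Summit.QuantumFields.YangMills.Theorems.FluctuationComparisonRegPrIntLS2BetaChartContChainCharts (isClosed_chainWindowGraph continuousOn_chainMap₂)
open Summit.QuantumFields.YangMills.Theorems.FluctuationComparisonRegPrIntLS2BetaChartContBlindChain (chain_forwardLaw_contOn_blind)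

namespace Summit.QuantumFields.YangMills.Theorems.FluctuationComparisonRegPrIntLS2BetaChartContBlindCharts

variable {P : Params} {N : ℕ} [NeZero N]

/-- ★★★ **PER-BOND INVERSION DATA OF THE CHAIN — JOINTLY CONTINUOUS AND PIVOT-BLIND**: ✓`exists_chainCharts_cont` (Part II; fifteen conjuncts VERBATIM) re-run on the
pivot-blind chain density ✓`chain_forwardLaw_contOn_blind`, plus (16) the image window `T c`, (17) the inverse `ϑ c · v` on it and (18) the inverse density `jd c · v` on it
are BLIND TO RESAMPLING THE PIVOTS `extend (iterCentralBond n) g` (✓`chainMap_extend`, ✓`chainWindow_extend`, uniqueness of the inverse).  ORIGINAL DOCSTRING — ✓`exists_chainCharts_lb` (F2) re-run on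
✓`chain_forwardLaw_contOn`, with two more conjuncts: the inverse chart `(U, v) ↦ ϑ c U v` and the inverse density `(U, v) ↦ jd c U v` are continuous on
`{(U, v) | U has small loop history below level n ∧ v ∈ T c U}`.  The inverse is `Literature.Topology.ParametricInverse.continuousOn_parametricInverse_of_compactSpace`
(parametrised inverses on compact fibres are jointly continuous: closed guarded window graph ✓`isClosed_chainWindowGraph`, jointly continuous chain map
✓`continuousOn_chainMap₂`, compact `SU(N)`, Hausdorff values); the density is `(J c U (ϑ c U v))⁻¹` with `J` jointly continuous (✓`chain_forwardLaw_contOn`).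
[cite: Balaban1987RG1, (0.4) p.253 and (2.10) p.267; BourbakiGT1, Ch. I §10 no. 2, Thm 1 Cor. 5; Kechris1995, Thm 15.1 and Cor 15.2] -/
theorem exists_chainCharts_cont_blind {α : ℝ} (hα0 : 0 ≤ α) (hα24 : α ≤ 1 / 24) (hα64 : 64 * α ≤ deltaSU (Fin N))
    (hαL : 157 * α < ((P.L : ℝ) ^ (P.d - 1))⁻¹)
    (hgap : ∀ j (c : PBond P (j + 1)), (offCard c : ℝ) / (Fintype.card (Idx P) : ℝ) + 150 * α < 1)
    {j₀ : ℝ≥0} (hvol : j₀ = 0 ∨ ChainVol P N α j₀) {n : ℕ} (hn : n ≤ P.m + P.K) :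
    ∃ (T : PBond P n → GaugeField P 0 (SU N) → Set (SU N)) (ϑ : PBond P n → GaugeField P 0 (SU N) → SU N → SU N)
      (jd : PBond P n → GaugeField P 0 (SU N) → SU N → ℝ≥0),
      (∀ c, MeasurableSet {p : GaugeField P 0 (SU N) × SU N | p.2 ∈ T c p.1}) ∧
      (∀ c, Measurable fun p : GaugeField P 0 (SU N) × SU N => ϑ c p.1 p.2) ∧
      (∀ c, Measurable fun p : GaugeField P 0 (SU N) × SU N => jd c p.1 p.2) ∧
      (∀ c U, ∀ v ∈ T c U, chainMap (expMeanLogSU (n := Fin N)) n U c (ϑ c U v) = v) ∧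
      (∀ c U, (HaarData.haar : Measure (SU N)).restrict (chainWindow α n U c) =
        (((HaarData.haar : Measure (SU N)).restrict (T c U)).withDensity fun v => (jd c U v : ℝ≥0∞)).map (ϑ c U)) ∧
      (∀ c U, T c U = chainMap (expMeanLogSU (n := Fin N)) n U c '' chainWindow α n U c) ∧
      (∀ c U, ∀ g ∈ chainWindow α n U c, ϑ c U (chainMap (expMeanLogSU (n := Fin N)) n U c g) = g) ∧
      (∀ c U, ∀ v ∈ T c U, ϑ c U v ∈ chainWindow α n U c) ∧
      (∀ c U, IsClosed (T c U)) ∧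
      (∀ c U, ContinuousOn (ϑ c U) (T c U)) ∧
      (∀ c U, ContinuousOn (jd c U) (T c U)) ∧
      (∀ c U, ∀ v ∈ T c U, jd c U v ≠ 0) ∧
      (∀ c U, ∀ v ∈ T c U, j₀ ^ n * jd c U v ≤ 1) ∧
      (∀ c, ContinuousOn (fun p : GaugeField P 0 (SU N) × SU N => ϑ c p.1 p.2)
        {p : GaugeField P 0 (SU N) × SU N |
          (∀ k, k < n → ∀ (c' : PBond P (k + 1)) (i : Idx P),
            dist1 (loopHol (Averaging.iter (fun i => BlockAveraging.blockAvg (P := P) (j := i) (expMeanLogSU (n := Fin N))) k p.1) c' i) ≤ α) ∧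
          p.2 ∈ T c p.1}) ∧
      (∀ c, ContinuousOn (fun p : GaugeField P 0 (SU N) × SU N => jd c p.1 p.2)
        {p : GaugeField P 0 (SU N) × SU N |
          (∀ k, k < n → ∀ (c' : PBond P (k + 1)) (i : Idx P),
            dist1 (loopHol (Averaging.iter (fun i => BlockAveraging.blockAvg (P := P) (j := i) (expMeanLogSU (n := Fin N))) k p.1) c' i) ≤ α) ∧
          p.2 ∈ T c p.1}) ∧
      (∀ c U (g : PBond P n → SU N), T c (extend (iterCentralBond n) g U) = T c U) ∧
      (∀ c U (g : PBond P n → SU N), ∀ v ∈ T c U, ϑ c (extend (iterCentralBond n) g U) v = ϑ c U v) ∧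
      (∀ c U (g : PBond P n → SU N), ∀ v ∈ T c U, jd c (extend (iterCentralBond n) g U) v = jd c U v) := by
  have hαδ : α < deltaSU (Fin N) := by nlinarith [deltaSU_pos (n := Fin N)]
  have hinj : ∀ (c : PBond P n) (U : GaugeField P 0 (SU N)),
      InjOn (fun g => chainMap (expMeanLogSU (n := Fin N)) n U c g) (chainWindow α n U c) :=
    fun c U => chainMap_injOn hα0 hα24 hαδ hgap hn U c
  have key : ∀ c : PBond P n, ∃ θ : GaugeField P 0 (SU N) × SU N → SU N, Measurable θ ∧
      (∀ U, ∀ g ∈ chainWindow α n U c, θ (U, chainMap (expMeanLogSU (n := Fin N)) n U c g) = g) ∧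
      (∀ U, ∀ v ∈ (fun g => chainMap (expMeanLogSU (n := Fin N)) n U c g) '' chainWindow α n U c,
        chainMap (expMeanLogSU (n := Fin N)) n U c (θ (U, v)) = v ∧ θ (U, v) ∈ chainWindow α n U c) := fun c =>
    (Literature.MeasureTheory.Function.exists_measurable_fibrewiseInverse
      (Ψ := fun p : GaugeField P 0 (SU N) × SU N => chainMap (expMeanLogSU (n := Fin N)) n p.1 c p.2)
      (Ω := fun U => chainWindow α n U c) (measurable_chainMap₂ n c) (measurableSet_chainWindow₂ α n c) (hinj c)).2
  have keyT : ∀ c : PBond P n, MeasurableSet {p : GaugeField P 0 (SU N) × SU N |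
      p.2 ∈ (fun g => chainMap (expMeanLogSU (n := Fin N)) n p.1 c g) '' chainWindow α n p.1 c} := fun c =>
    (Literature.MeasureTheory.Function.exists_measurable_fibrewiseInverse
      (Ψ := fun p : GaugeField P 0 (SU N) × SU N => chainMap (expMeanLogSU (n := Fin N)) n p.1 c p.2)
      (Ω := fun U => chainWindow α n U c) (measurable_chainMap₂ n c) (measurableSet_chainWindow₂ α n c) (hinj c)).1
  choose θ hθm hleft hright using key
  have hJ := fun c => chain_forwardLaw_contOn_blind (N := N) (P := P) hα0 hα24 hα64 hαL hgap hvol n hn c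
  choose J hJm hJ0 hJlaw hJc hJlb hJg hJbl using hJ
  -- blindness of the image window and of the inverse to resampling the pivots
  have hTbl : ∀ (c : PBond P n) (U : GaugeField P 0 (SU N)) (g : PBond P n → SU N),
      (fun g' => chainMap (expMeanLogSU (n := Fin N)) n (extend (iterCentralBond n) g U) c g') '' chainWindow α n (extend (iterCentralBond n) g U) c =
        (fun g' => chainMap (expMeanLogSU (n := Fin N)) n U c g') '' chainWindow α n U c := fun c U g => by
    rw [chainWindow_extend α hn g U c]
    refine image_congr fun g' _ => ?_
    rw [chainMap_extend _ hn g U c]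
  have hθbl : ∀ (c : PBond P n) (U : GaugeField P 0 (SU N)) (g : PBond P n → SU N),
      ∀ v ∈ (fun g' => chainMap (expMeanLogSU (n := Fin N)) n U c g') '' chainWindow α n U c,
        θ c (extend (iterCentralBond n) g U, v) = θ c (U, v) := fun c U g v hv => by
    have hv' : v ∈ (fun g' => chainMap (expMeanLogSU (n := Fin N)) n (extend (iterCentralBond n) g U) c g') ''
        chainWindow α n (extend (iterCentralBond n) g U) c := by rw [hTbl c U g]; exact hv
    have h1 := hright c _ v hv'
    have h2 := hright c U v hv
    rw [chainWindow_extend α hn g U c, chainMap_extend _ hn g U c] at h1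
    exact hinj c U h1.2 h2.2 (h1.1.trans h2.1.symm)
  have hθc : ∀ (c : PBond P n) (U : GaugeField P 0 (SU N)),
      ContinuousOn (fun v => θ c (U, v)) ((fun g => chainMap (expMeanLogSU (n := Fin N)) n U c g) '' chainWindow α n U c) := fun c U =>
    continuousOn_leftInverse_image (isClosed_chainWindow hαδ hn U c) (continuousOn_chainMap hαδ hn U c) (hinj c U)
      (θ := fun v => θ c (U, v)) (fun v hv => (hright c U v hv).2) (fun v hv => (hright c U v hv).1)
  -- ★ joint continuity of the inverse on the guarded image graph (parametrised inverse on compact fibres)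
  have hθg : ∀ c : PBond P n, ContinuousOn (fun p : GaugeField P 0 (SU N) × SU N => θ c (p.1, p.2))
      {p : GaugeField P 0 (SU N) × SU N |
        (∀ k, k < n → ∀ (c' : PBond P (k + 1)) (i : Idx P),
          dist1 (loopHol (Averaging.iter (fun i => BlockAveraging.blockAvg (P := P) (j := i) (expMeanLogSU (n := Fin N))) k p.1) c' i) ≤ α) ∧
        p.2 ∈ (fun g => chainMap (expMeanLogSU (n := Fin N)) n p.1 c g) '' chainWindow α n p.1 c} := by
    intro c
    have h := Literature.Topology.ParametricInverse.continuousOn_parametricInverse_of_compactSpace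
      (P := GaugeField P 0 (SU N)) (X := SU N) (Y := SU N)
      (F := fun U g => chainMap (expMeanLogSU (n := Fin N)) n U c g)
      (K := fun U => {g : SU N |
        (∀ k, k < n → ∀ (c' : PBond P (k + 1)) (i : Idx P),
          dist1 (loopHol (Averaging.iter (fun i => BlockAveraging.blockAvg (P := P) (j := i) (expMeanLogSU (n := Fin N))) k U) c' i) ≤ α) ∧
        g ∈ chainWindow (N := N) α n U c})
      (ϑ := fun U v => θ c (U, v)) (isClosed_chainWindowGraph (P := P) (N := N) hαδ hn c) (continuousOn_chainMap₂ (P := P) (N := N) hαδ hn c)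
      (fun U g hg => hleft c U g hg.2)
    refine h.mono fun p hp => ?_
    obtain ⟨g, hg, hgp⟩ := hp.2
    exact ⟨g, ⟨hp.1, hg⟩, hgp⟩
  refine ⟨fun c U => (fun g => chainMap (expMeanLogSU (n := Fin N)) n U c g) '' chainWindow α n U c, fun c U v => θ c (U, v),
    fun c U v => (J c U (θ c (U, v)))⁻¹, keyT, fun c => hθm c, fun c => ?_, fun c U v hv => (hright c U v hv).1, fun c U => ?_,
    fun c U => rfl, fun c U g hg => hleft c U g hg, fun c U v hv => (hright c U v hv).2,
    fun c U => isClosed_image_chainWindow hαδ hn U c, hθc, fun c U => ?_, fun c U v hv => inv_ne_zero (hJ0 c U _ (hright c U v hv).2),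
    fun c U v hv => ?lb, hθg, fun c => ?jdg, fun c U g => hTbl c U g, fun c U g v hv => hθbl c U g v hv, fun c U g v hv => ?jdbl⟩
  case jdbl =>
    show (J c (extend (iterCentralBond n) g U) (θ c (extend (iterCentralBond n) g U, v)))⁻¹ = (J c U (θ c (U, v)))⁻¹
    rw [hθbl c U g v hv, hJbl]
  case lb =>
    have hx : J c U (θ c (U, v)) ≠ 0 := hJ0 c U _ (hright c U v hv).2
    calc j₀ ^ n * (J c U (θ c (U, v)))⁻¹ ≤ J c U (θ c (U, v)) * (J c U (θ c (U, v)))⁻¹ := mul_le_mul' (hJlb c U _) le_rfl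
      _ = 1 := mul_inv_cancel₀ hx
  case jdg =>
    have hcomp : ContinuousOn (fun p : GaugeField P 0 (SU N) × SU N => J c p.1 (θ c (p.1, p.2)))
        {p : GaugeField P 0 (SU N) × SU N |
          (∀ k, k < n → ∀ (c' : PBond P (k + 1)) (i : Idx P),
            dist1 (loopHol (Averaging.iter (fun i => BlockAveraging.blockAvg (P := P) (j := i) (expMeanLogSU (n := Fin N))) k p.1) c' i) ≤ α) ∧
          p.2 ∈ (fun g => chainMap (expMeanLogSU (n := Fin N)) n p.1 c g) '' chainWindow α n p.1 c} :=
      (hJg c).comp (continuousOn_fst.prodMk (hθg c)) fun p hp => ⟨hp.1, (hright c p.1 p.2 hp.2).2⟩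
    exact hcomp.inv₀ fun p hp => hJ0 c p.1 _ (hright c p.1 p.2 hp.2).2
  · exact ((hJm c).comp (measurable_fst.prodMk (hθm c))).inv
  rotate_left
  · exact ((hJc c U).comp (hθc c U) fun v hv => (hright c U v hv).2).inv₀ fun v hv => hJ0 c U _ (hright c U v hv).2
  · -- the inverse law from the forward law
    have hΩU : MeasurableSet (chainWindow α n U c) := measurableSet_chainWindow α n U c
    have hθU : Measurable fun v => θ c (U, v) := (hθm c).comp (measurable_const.prodMk measurable_id)
    have hjacU : Measurable fun g => (J c U g : ℝ≥0∞) :=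
      measurable_coe_nnreal_ennreal.comp ((hJm c).comp (measurable_const.prodMk measurable_id))
    have h := T4TriangularFibredChart.restrict_eq_map_withDensity_of_leftInvOn (ν := (HaarData.haar : Measure (SU N))) hΩU
      (measurable_chainMap n U c) hθU (hleft c U) hjacU (fun g hg => by exact_mod_cast hJ0 c U g hg) (fun g _ => ENNReal.coe_ne_top) (hJlaw c U)
    rw [h]
    congr 1
    refine withDensity_congr_ae ?_
    filter_upwards [ae_restrict_mem (keyT c |> fun h => (measurable_const.prodMk measurable_id) h)] with v hv
    rw [ENNReal.coe_inv (hJ0 c U _ ((hright c U v hv).2))]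

end Summit.QuantumFields.YangMills.Theorems.FluctuationComparisonRegPrIntLS2BetaChartContBlindCharts

end
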